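import Literature.MathematicalPhysics.QuantumFieldTheory.Balaban1983to89.B9Eq310HessianOperator

/-!
# `Balaban1983to89.B9Ineq369CurvatureSmall` — T. Bałaban, *Propagators for lattice gauge theories in a background field*, Commun. Math. Phys. **99**
# (1985) 389–434 [Balaban1985BackgroundPropagators] p. 392 / (3.69) p. 404: THE CURVATURE PART `Δ′(U)` OF THE HESSIAN (3.10) IS A SMALL
# OPERATOR — `|⟨A, Δ′(U)A⟩| ≤ 32d·C_τ·M_φ²·(η^d/c₀)·(η⁻²ε)·‖A‖²` on the `L²` bond space when every plaquette holonomy is `ε`-close to `1` —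
# and POSITIVITY OF `Δ_a(U)` ([B9] Thm 3.11, the pub-balaban NE9 chain's displayed `hpos`) REDUCES TO THE COERCIVITY OF ITS PRINCIPAL PART
# `D*D + DRD* + aQ*Q`

statement-level skeleton of published theorems with citation tags; proofs where landed; nothing here is a claim
about the Yang–Mills mass gap

PDF held: `paper:balaban1985-cmp99-background-propagators` (journal page = PDF page + 388), pp. 392, 404; read by this seat (2026-08-21) in the held text.

THE PRINT (verbatim).  p. 392, after (3.10): *«We have written it this way because with our assumptions on the configuration U the operator Δ′ will
be a bounded, small operator, which will be treated as a small perturbation of D*D.»*  p. 404, (3.69): *«From the formula (3.10) it follows that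
Δ′(U′U) is a small perturbation itself in the sense that we have the bound |(Δ′(U′U)A′)(b)| ≤ O(1)(L^jα₀ + α₁)(L^jη)⁻² sup |A′(b′)|, b ∈ Ω_j (3.69)
the supremum on the right-hand side is taken over bonds belonging to one of the plaquettes containing the bond b […] This bound follows from the
estimates |Re U′U(∂p) − 1| ≤ …, |Im U′U(∂p)| ≤ … and the estimates follow directly from the assumptions (3.35), (3.37).»*

WHY THIS FILE (cell context).  After the pub-balaban NE9 owner's gen-78 files the chart of the curve species `cur U` exists at the constructed
letters given ONLY the (L3) slot `W` and the displayed positivity `hpos : ∀ x ≠ 0, 0 < re⟪x, Δ_a(U)x⟫` of the assembled operator (3.26) with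
`Δ(U) = D*D + Δ′(U)` (`B9Eq310HessianOperator.hessOp = principalOpK + curvOp`).  Print's proof of Thm 3.11 treats `Δ′` as a perturbation.  This file
proves the perturbation bound at the level of the tree's objects — the `L²` quadratic form of `curvOp` is `O(η⁻²ε)`-small (the mechanism of
(3.69): every term of (3.10) carries a factor `Re U(∂p) − 1` or `Im U(∂p)`, each of norm `≤ ε` when `‖U(∂p) − 1‖ ≤ ε` and the bond variables are
unit-bounded with unit-bounded inverses) — and SPLITS `hpos`: it follows from the coercivity `re⟪x, (D*D + DRD* + aQ*Q)x⟫ ≥ γ‖x‖²` of the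
principal gauge-fixed operator with `γ` larger than the perturbation constant.  (The coercivity — the content of Thm 3.11 / of [4] for the flat
case — is NOT proved here.)  The tree's sup-norm form of (3.69) for the `ℤ^d`-model operator is `B9Eq310Hermitian.norm_deltaPrimeOp_le` (lit-balaban
pv27) with `B9Eq310DeltaPrimeJunction` (NE9 leaf-04); this file works directly on E155/E157's `curvForm`/`curvOp`.

WHAT IS PROVED (sorry-free; no `Prop` placeholder; no inequality of the paper asserted as a hypothesis-free fact).
* §1 per plaquette: `edgeBond`, `norm_edgeLin_le` (`‖A′(b)‖ ≤ ‖A(b)‖`), `norm_curlAt_le`, `norm_plaqHolU_le`, **`norm_reHol_sub_one_le`**, **`norm_imHol_le`**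
  (`≤ ε`), `norm_curvBlock₁_le`, `norm_curvBlock₂_le`, **`norm_curvForm_le`**:
  `‖curvForm τ η U A B‖ ≤ 2·C_τ·ε·|η|^d·η⁻²·Σ_p (Σ_{b⊂∂p}‖A(b)‖)(Σ_{b⊂∂p}‖B(b)‖)`.
* §2 incidence: `edgeCode_injective`, **`sum_edge_le`** (`Σ_{p,k} g(e_k(p)) ≤ 4d·Σ_b g(b)` for `g ≥ 0`).
* §3 on the `L²` space: **`norm_inner_curvOp_self_le`**: `‖⟪x, Δ′(U)x⟫‖ ≤ 32d·C_τ·M_φ²·(|η|^d/c₀)·η⁻²·ε·‖x‖²` (`C_τ`, `M_φ` bounds of the trace datum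
  and of the fibre identification; `‖X*‖ = ‖X‖`).
* §4 **`hpos_of_principal_coercive`**: if `γ‖x‖² ≤ re⟪x, laplaceALatticeK c R S (principalOpK φ η U) Rr Q a x⟫` for all `x` and the §3 constant is
  `< γ`, then `0 < re⟪x, laplaceALatticeK c R S (hessOp φ η U τ) Rr Q a x⟫` for `x ≠ 0` — the displayed `hpos` of `B9Eq326OperatorAssembly` /
  `B9Eq315QTorus` / `B9Eq326OperatorTower` REDUCED to the principal coercivity; §5 **`hpos_of_smallCurvature`** composes §3 + §4 (the `hpos`
  binder in exactly the consumers' shape, from the coercivity + the smallness letters).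
MODEL / DECLARED READINGS.  (M1) as E155/E157 (torus `TSite d Pd`, fibre `W ≃ 𝔸` via `φ`, trace datum `τ`, weight `c₀`, scalar `η⁻¹`); `𝔸` a normed
`*`-algebra with isometric star (`NormedStarGroup`).  (M2) hypotheses: unit-bounded bond variables with unit-bounded inverses (unitaries), plaquette
holonomies `ε`-close to `1` (print's (3.35): `ε = O(α₀η²)` on the `η`-lattice, so that `η⁻²ε = O(α₀)`), `‖τX‖ ≤ C_τ‖X‖`, `‖φw‖ ≤ M_φ‖w‖`.  (M3) the
constants `2`, `4d`, `32d` are this file's witnesses for print's `O(1)`; the local (pointwise) form of (3.69) is pv27's, not restated.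
HONEST SCOPE.  An elementary perturbation bound + a reduction; the coercivity of the principal part (the substance of [B9] Thm 3.11 / [4]) stays
DISPLAYED; NOT summit progress (cell pub-balaban: NE9 NOT PRINTED / NOT PROVED; spine PROVED 0/9).  Filed by the pub-balaban NE9 BINDER-row owner
lineage `b2b-balaban-t4-ne9-p1` (gen 78); NEW file importing `B9Eq310HessianOperator` only; nothing modified.  Net new unproved facts: 0.
-/

noncomputable section

open scoped InnerProductSpace ComplexConjugate BigOperators
open Finset

namespace Literature.MathematicalPhysics.QuantumFieldTheory.Balaban1983to89.B9Ineq369CurvatureSmall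

open B9SectCLatticeCarrier (Bond DirPair shift unshift shift_unshift unshift_shift)
open B4Sect5Torus (TSite)
open B9Eq311L2Pairing (WL2)
open B9Eq310DeltaPrime (plaqHolU reHol imHol edgeLin edgeLin_zero edgeLin_one edgeLin_two edgeLin_three curlAt curlAt_eq_smul_sum_edgeLin
  orderedPairs mem_orderedPairs curvBlock₁ curvBlock₁_apply curvBlock₂ curvBlock₂_apply curvForm curvForm_apply)
open B9Eq310HessianOperator (toAlg curvOp inner_curvOp principalOpK hessOp hessOp_apply)
open B11Eq103H1Complex (BondL2K SiteL2K laplaceALatticeK funEquiv_apply)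

variable {d : ℕ} {Pd : Fin d → ℕ}

/-! ## §1 Per-plaquette bounds: every term of (3.10) carries `Re U(∂p) − 1` or `Im U(∂p)` -/

section Plaquette

variable {𝔸 : Type*} [NormedRing 𝔸] [NormedAlgebra ℂ 𝔸]

/-- The four (positively oriented) bonds of `∂p`, `p = p_{μν}(x)`, in the order of `B9Eq310DeltaPrime.edgeLin`: `⟨x+e_ν, μ⟩`, `⟨x, ν⟩`, `⟨x, μ⟩`,
`⟨x+e_μ, ν⟩`. [cite: Balaban1985BackgroundPropagators, (3.2) p.390] -/
def edgeBond (p : B9SectCLatticeCarrier.Plaq d Pd) : Fin 4 → Bond d Pd :=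
  ![(shift p.2.1.2 p.1, p.2.1.1), (p.1, p.2.1.2), (p.1, p.2.1.1), (shift p.2.1.1 p.1, p.2.1.2)]

omit [NormedAlgebra ℂ 𝔸] in
/-- conjugation by a unit-bounded unit with unit-bounded inverse does not increase norms. [cite: Balaban1985BackgroundPropagators, (3.2) p.390] -/
theorem norm_conj_le {u : 𝔸ˣ} (hu : ‖(u : 𝔸)‖ ≤ 1 ∧ ‖((u⁻¹ : 𝔸ˣ) : 𝔸)‖ ≤ 1) (X : 𝔸) : ‖(u : 𝔸) * X * ((u⁻¹ : 𝔸ˣ) : 𝔸)‖ ≤ ‖X‖ := by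
  calc ‖(u : 𝔸) * X * ((u⁻¹ : 𝔸ˣ) : 𝔸)‖ ≤ ‖(u : 𝔸)‖ * ‖X‖ * ‖((u⁻¹ : 𝔸ˣ) : 𝔸)‖ :=
        (norm_mul_le _ _).trans (mul_le_mul_of_nonneg_right (norm_mul_le _ _) (norm_nonneg _))
    _ ≤ 1 * ‖X‖ * 1 := by gcongr <;> [exact hu.1; exact hu.2]
    _ = ‖X‖ := by ring

variable {U : Bond d Pd → 𝔸ˣ} (hU : ∀ b, ‖(U b : 𝔸)‖ ≤ 1 ∧ ‖(((U b)⁻¹ : 𝔸ˣ) : 𝔸)‖ ≤ 1)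
include hU

/-- **`‖A′(b)‖ ≤ ‖A(b)‖`**: the transported edge variables of p. 390 are rotations (or negatives) of the bond variables.
[cite: Balaban1985BackgroundPropagators, (3.2) p.390] -/
theorem norm_edgeLin_le (p : B9SectCLatticeCarrier.Plaq d Pd) (k : Fin 4) (A : Bond d Pd → 𝔸) : ‖edgeLin U p k A‖ ≤ ‖A (edgeBond p k)‖ := by
  obtain ⟨x, q⟩ := p
  fin_cases k
  · show ‖edgeLin U (x, q) 0 A‖ ≤ ‖A (shift q.1.2 x, q.1.1)‖
    rw [edgeLin_zero, norm_neg]; exact norm_conj_le (hU _) _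
  · show ‖edgeLin U (x, q) 1 A‖ ≤ ‖A (x, q.1.2)‖
    rw [edgeLin_one, norm_neg]
  · show ‖edgeLin U (x, q) 2 A‖ ≤ ‖A (x, q.1.1)‖
    rw [edgeLin_two]
  · show ‖edgeLin U (x, q) 3 A‖ ≤ ‖A (shift q.1.1 x, q.1.2)‖
    rw [edgeLin_three]; exact norm_conj_le (hU _) _

/-- **`‖(D_U A)(p)‖ ≤ |c|·Σ_{b⊂∂p}‖A(b)‖`** ((3.4): the curl is `c` times the sum of the four transported edge variables).
[cite: Balaban1985BackgroundPropagators, (3.4) p.391] -/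
theorem norm_curlAt_le (c : ℂ) (p : B9SectCLatticeCarrier.Plaq d Pd) (A : Bond d Pd → 𝔸) : ‖curlAt c U p A‖ ≤ ‖c‖ * ∑ k : Fin 4, ‖A (edgeBond p k)‖ := by
  rw [curlAt_eq_smul_sum_edgeLin, norm_smul]
  exact mul_le_mul_of_nonneg_left ((norm_sum_le _ _).trans (sum_le_sum fun k _ => norm_edgeLin_le hU p k A)) (norm_nonneg _)

omit [NormedAlgebra ℂ 𝔸] in
/-- The plaquette holonomy and its inverse are unit-bounded. [cite: Balaban1985BackgroundPropagators, (3.1) p.390] -/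
theorem norm_plaqHolU_le (p : B9SectCLatticeCarrier.Plaq d Pd) : ‖(plaqHolU U p : 𝔸)‖ ≤ 1 ∧ ‖(((plaqHolU U p)⁻¹ : 𝔸ˣ) : 𝔸)‖ ≤ 1 := by
  have hm : ∀ {u v : 𝔸ˣ}, (‖(u : 𝔸)‖ ≤ 1 ∧ ‖((u⁻¹ : 𝔸ˣ) : 𝔸)‖ ≤ 1) → (‖(v : 𝔸)‖ ≤ 1 ∧ ‖((v⁻¹ : 𝔸ˣ) : 𝔸)‖ ≤ 1) →
      (‖((u * v : 𝔸ˣ) : 𝔸)‖ ≤ 1 ∧ ‖(((u * v)⁻¹ : 𝔸ˣ) : 𝔸)‖ ≤ 1) := fun hu hv =>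
    ⟨by rw [Units.val_mul]; exact (norm_mul_le _ _).trans (mul_le_one₀ hu.1 (norm_nonneg _) hv.1),
     by rw [mul_inv_rev, Units.val_mul]; exact (norm_mul_le _ _).trans (mul_le_one₀ hv.2 (norm_nonneg _) hu.2)⟩
  have hi : ∀ {u : 𝔸ˣ}, (‖(u : 𝔸)‖ ≤ 1 ∧ ‖((u⁻¹ : 𝔸ˣ) : 𝔸)‖ ≤ 1) → (‖((u⁻¹ : 𝔸ˣ) : 𝔸)‖ ≤ 1 ∧ ‖(((u⁻¹)⁻¹ : 𝔸ˣ) : 𝔸)‖ ≤ 1) :=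
    fun hu => ⟨hu.2, by rw [inv_inv]; exact hu.1⟩
  unfold plaqHolU
  exact hm (hm (hm (hU _) (hU _)) (hi (hU _))) (hi (hU _))

/-- **`‖Re U(∂p) − 1‖ ≤ ε`** when `‖U(∂p) − 1‖ ≤ ε` (then also `‖U(∂p)⁻¹ − 1‖ ≤ ε` by unit-boundedness): print's «the estimates follow directly from the
assumptions (3.35)». [cite: Balaban1985BackgroundPropagators, (3.69) p.404, (3.35) p.396] -/
theorem norm_reHol_sub_one_le {p : B9SectCLatticeCarrier.Plaq d Pd} {ε : ℝ} (hp : ‖(plaqHolU U p : 𝔸) - 1‖ ≤ ε) : ‖reHol U p - 1‖ ≤ ε := by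
  have hinv : ‖(((plaqHolU U p)⁻¹ : 𝔸ˣ) : 𝔸) - 1‖ ≤ ε := by
    have h1 : (((plaqHolU U p)⁻¹ : 𝔸ˣ) : 𝔸) - 1 = (((plaqHolU U p)⁻¹ : 𝔸ˣ) : 𝔸) * (1 - (plaqHolU U p : 𝔸)) := by
      rw [mul_sub, mul_one, Units.inv_mul]
    rw [h1]
    calc _ ≤ ‖(((plaqHolU U p)⁻¹ : 𝔸ˣ) : 𝔸)‖ * ‖1 - (plaqHolU U p : 𝔸)‖ := norm_mul_le _ _
      _ ≤ 1 * ‖1 - (plaqHolU U p : 𝔸)‖ := by gcongr; exact (norm_plaqHolU_le hU p).2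
      _ ≤ ε := by rw [one_mul, norm_sub_rev]; exact hp
  have h : reHol U p - 1 = (1 / 2 : ℂ) • (((plaqHolU U p : 𝔸) - 1) + ((((plaqHolU U p)⁻¹ : 𝔸ˣ) : 𝔸) - 1)) := by
    rw [reHol]; module
  rw [h, norm_smul]
  have hn : ‖(1 / 2 : ℂ)‖ = 1 / 2 := by simp
  rw [hn]
  linarith [norm_add_le ((plaqHolU U p : 𝔸) - 1) ((((plaqHolU U p)⁻¹ : 𝔸ˣ) : 𝔸) - 1)]

/-- **`‖Im U(∂p)‖ ≤ ε`** when `‖U(∂p) − 1‖ ≤ ε`. [cite: Balaban1985BackgroundPropagators, (3.69) p.404, (3.35) p.396] -/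
theorem norm_imHol_le {p : B9SectCLatticeCarrier.Plaq d Pd} {ε : ℝ} (hp : ‖(plaqHolU U p : 𝔸) - 1‖ ≤ ε) : ‖imHol U p‖ ≤ ε := by
  have hinv : ‖(((plaqHolU U p)⁻¹ : 𝔸ˣ) : 𝔸) - 1‖ ≤ ε := by
    have h1 : (((plaqHolU U p)⁻¹ : 𝔸ˣ) : 𝔸) - 1 = (((plaqHolU U p)⁻¹ : 𝔸ˣ) : 𝔸) * (1 - (plaqHolU U p : 𝔸)) := by
      rw [mul_sub, mul_one, Units.inv_mul]
    rw [h1]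
    calc _ ≤ ‖(((plaqHolU U p)⁻¹ : 𝔸ˣ) : 𝔸)‖ * ‖1 - (plaqHolU U p : 𝔸)‖ := norm_mul_le _ _
      _ ≤ 1 * ‖1 - (plaqHolU U p : 𝔸)‖ := by gcongr; exact (norm_plaqHolU_le hU p).2
      _ ≤ ε := by rw [one_mul, norm_sub_rev]; exact hp
  have h : imHol U p = (-Complex.I / 2) • (((plaqHolU U p : 𝔸) - 1) - ((((plaqHolU U p)⁻¹ : 𝔸ˣ) : 𝔸) - 1)) := by
    rw [imHol, sub_sub_sub_cancel_right]
  rw [h, norm_smul]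
  have hn : ‖(-Complex.I / 2 : ℂ)‖ = 1 / 2 := by simp
  rw [hn]
  linarith [norm_sub_le ((plaqHolU U p : 𝔸) - 1) ((((plaqHolU U p)⁻¹ : 𝔸ˣ) : 𝔸) - 1)]

variable {τ : 𝔸 →ₗ[ℂ] ℂ} {Cτ : ℝ} (hτ : ∀ X, ‖τ X‖ ≤ Cτ * ‖X‖) (η : ℝ)
include hτ

/-- the edge sum of a plaquette. [cite: Balaban1985BackgroundPropagators, (3.2) p.390] -/
abbrev edgeSum (p : B9SectCLatticeCarrier.Plaq d Pd) (A : Bond d Pd → 𝔸) : ℝ := ∑ k : Fin 4, ‖A (edgeBond p k)‖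

omit [NormedAlgebra ℂ 𝔸] hU hτ in
/-- the edge sum is nonnegative. [cite: Balaban1985BackgroundPropagators, (3.2) p.390] -/
theorem edgeSum_nonneg (p : B9SectCLatticeCarrier.Plaq d Pd) (A : Bond d Pd → 𝔸) : 0 ≤ edgeSum p A := sum_nonneg fun _ _ => norm_nonneg _

/-- **The field-strength block of (3.10) is `O(ε)`**: `‖curvBlock₁ A B‖ ≤ C_τ·ε·η⁻²·(Σ_{∂p}‖A‖)(Σ_{∂p}‖B‖)`. [cite: Balaban1985BackgroundPropagators, (3.10) p.392, (3.69) p.404] -/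
theorem norm_curvBlock₁_le (hCτ : 0 ≤ Cτ) {p : B9SectCLatticeCarrier.Plaq d Pd} {ε : ℝ} (hp : ‖(plaqHolU U p : 𝔸) - 1‖ ≤ ε) (A B : Bond d Pd → 𝔸) :
    ‖curvBlock₁ τ η U p A B‖ ≤ Cτ * ε * ‖((η : ℂ))⁻¹‖ ^ 2 * edgeSum p A * edgeSum p B := by
  have hε : 0 ≤ ε := (norm_nonneg _).trans hp
  have hA := norm_curlAt_le hU ((η : ℂ))⁻¹ p A
  have hB := norm_curlAt_le hU ((η : ℂ))⁻¹ p B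
  have hR := norm_reHol_sub_one_le hU hp
  have key : ∀ X Y : 𝔸, ‖τ (X * Y * (reHol U p - 1))‖ ≤ Cτ * (‖X‖ * ‖Y‖ * ε) := fun X Y =>
    (hτ _).trans (mul_le_mul_of_nonneg_left (((norm_mul_le _ _).trans (mul_le_mul (norm_mul_le _ _) hR (norm_nonneg _)
      (mul_nonneg (norm_nonneg _) (norm_nonneg _))))) hCτ)
  rw [curvBlock₁_apply, norm_mul, show ‖(1 / 2 : ℂ)‖ = 1 / 2 by simp]
  have h1 := key (curlAt ((η : ℂ))⁻¹ U p A) (curlAt ((η : ℂ))⁻¹ U p B)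
  have h2 := key (curlAt ((η : ℂ))⁻¹ U p B) (curlAt ((η : ℂ))⁻¹ U p A)
  have hprod : ‖curlAt ((η : ℂ))⁻¹ U p A‖ * ‖curlAt ((η : ℂ))⁻¹ U p B‖ ≤ ‖((η : ℂ))⁻¹‖ ^ 2 * edgeSum p A * edgeSum p B := by
    calc _ ≤ (‖((η : ℂ))⁻¹‖ * edgeSum p A) * (‖((η : ℂ))⁻¹‖ * edgeSum p B) :=
          mul_le_mul hA hB (norm_nonneg _) (mul_nonneg (norm_nonneg _) (edgeSum_nonneg p A))
      _ = _ := by ring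
  have := norm_add_le (τ (curlAt ((η : ℂ))⁻¹ U p A * curlAt ((η : ℂ))⁻¹ U p B * (reHol U p - 1)))
    (τ (curlAt ((η : ℂ))⁻¹ U p B * curlAt ((η : ℂ))⁻¹ U p A * (reHol U p - 1)))
  nlinarith [mul_comm ‖curlAt ((η : ℂ))⁻¹ U p A‖ ‖curlAt ((η : ℂ))⁻¹ U p B‖, mul_nonneg hCτ hε,
    mul_nonneg (mul_nonneg hCτ hε) (mul_nonneg (mul_nonneg (sq_nonneg ‖((η : ℂ))⁻¹‖) (edgeSum_nonneg p A)) (edgeSum_nonneg p B))]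

/-- **The commutator block of (3.10) is `O(ε)`**: `‖curvBlock₂ A B‖ ≤ C_τ·ε·η⁻²·(Σ_{∂p}‖A‖)(Σ_{∂p}‖B‖)`. [cite: Balaban1985BackgroundPropagators, (3.10) p.392, (3.69) p.404] -/
theorem norm_curvBlock₂_le (hCτ : 0 ≤ Cτ) {p : B9SectCLatticeCarrier.Plaq d Pd} {ε : ℝ} (hp : ‖(plaqHolU U p : 𝔸) - 1‖ ≤ ε) (A B : Bond d Pd → 𝔸) :
    ‖curvBlock₂ τ η U p A B‖ ≤ Cτ * ε * ‖((η : ℂ))⁻¹‖ ^ 2 * edgeSum p A * edgeSum p B := by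
  have hε : 0 ≤ ε := (norm_nonneg _).trans hp
  have hI := norm_imHol_le hU hp
  set M : 𝔸 := (((η : ℂ))⁻¹) ^ 2 • imHol U p with hM
  have hMn : ‖M‖ ≤ ‖((η : ℂ))⁻¹‖ ^ 2 * ε := by rw [hM, norm_smul, norm_pow]; exact mul_le_mul_of_nonneg_left hI (by positivity)
  set a : Fin 4 → ℝ := fun k => ‖A (edgeBond p k)‖ with ha
  set b : Fin 4 → ℝ := fun k => ‖B (edgeBond p k)‖ with hb
  have hea : ∀ k, ‖edgeLin U p k A‖ ≤ a k := fun k => norm_edgeLin_le hU p k A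
  have heb : ∀ k, ‖edgeLin U p k B‖ ≤ b k := fun k => norm_edgeLin_le hU p k B
  -- one commutator-trace term
  have key : ∀ (X Y X' Y' : 𝔸) (x y : ℝ), ‖X‖ ≤ x → ‖Y‖ ≤ y → ‖X'‖ ≤ y → ‖Y'‖ ≤ x →
      ‖τ ((X * Y - X' * Y') * M)‖ ≤ Cτ * (2 * (x * y) * (‖((η : ℂ))⁻¹‖ ^ 2 * ε)) := by
    intro X Y X' Y' x y hX hY hX' hY'
    have hx : 0 ≤ x := (norm_nonneg _).trans hX
    have hy : 0 ≤ y := (norm_nonneg _).trans hY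
    refine (hτ _).trans (mul_le_mul_of_nonneg_left ?_ hCτ)
    refine (norm_mul_le _ _).trans ?_
    have hcomm : ‖X * Y - X' * Y'‖ ≤ 2 * (x * y) := by
      refine (norm_sub_le _ _).trans ?_
      have h1 : ‖X * Y‖ ≤ x * y := (norm_mul_le _ _).trans (mul_le_mul hX hY (norm_nonneg _) hx)
      have h2 : ‖X' * Y'‖ ≤ y * x := (norm_mul_le _ _).trans (mul_le_mul hX' hY' (norm_nonneg _) hy)
      linarith [mul_comm x y]
    exact mul_le_mul hcomm hMn (norm_nonneg _) (by positivity)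
  rw [curvBlock₂_apply]
  refine (norm_sum_le _ _).trans ?_
  have hterm : ∀ kl ∈ orderedPairs, ‖Complex.I / 2 *
      (τ ((edgeLin U p kl.1 A * edgeLin U p kl.2 B - edgeLin U p kl.2 B * edgeLin U p kl.1 A) * M) +
        τ ((edgeLin U p kl.1 B * edgeLin U p kl.2 A - edgeLin U p kl.2 A * edgeLin U p kl.1 B) * M))‖ ≤
      Cτ * (‖((η : ℂ))⁻¹‖ ^ 2 * ε) * (a kl.1 * b kl.2 + b kl.1 * a kl.2) := fun kl _ => by
    rw [norm_mul, show ‖Complex.I / 2‖ = 1 / 2 by simp]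
    have h1 := key _ _ _ _ (a kl.1) (b kl.2) (hea kl.1) (heb kl.2) (heb kl.2) (hea kl.1)
    have h2 := key _ _ _ _ (b kl.1) (a kl.2) (heb kl.1) (hea kl.2) (hea kl.2) (heb kl.1)
    have := norm_add_le (τ ((edgeLin U p kl.1 A * edgeLin U p kl.2 B - edgeLin U p kl.2 B * edgeLin U p kl.1 A) * M))
      (τ ((edgeLin U p kl.1 B * edgeLin U p kl.2 A - edgeLin U p kl.2 A * edgeLin U p kl.1 B) * M))
    nlinarith
  refine (sum_le_sum hterm).trans ?_
  rw [← mul_sum]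
  -- `Σ_{k<l} (a_k b_l + b_k a_l) ≤ (Σ a)(Σ b)`
  have hpairs : ∑ kl ∈ orderedPairs, (a kl.1 * b kl.2 + b kl.1 * a kl.2) ≤ edgeSum p A * edgeSum p B := by
    have hsub : ∑ kl ∈ orderedPairs, (a kl.1 * b kl.2 + b kl.1 * a kl.2) ≤ ∑ kl : Fin 4 × Fin 4, a kl.1 * b kl.2 := by
      rw [sum_add_distrib]
      have hswap : ∑ kl ∈ orderedPairs, b kl.1 * a kl.2 = ∑ kl ∈ orderedPairs.image Prod.swap, a kl.1 * b kl.2 := by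
        rw [sum_image (fun x _ y _ h => Prod.swap_injective h)]
        exact sum_congr rfl fun kl _ => by simp [mul_comm]
      rw [hswap, ← sum_union]
      · refine sum_le_sum_of_subset_of_nonneg (subset_univ _) fun kl _ _ => mul_nonneg (norm_nonneg _) (norm_nonneg _)
      · rw [disjoint_left]
        intro kl h1 h2
        rw [mem_orderedPairs] at h1
        obtain ⟨kl', h2', rfl⟩ := mem_image.1 h2
        rw [mem_orderedPairs] at h2'
        simp only [Prod.fst_swap, Prod.snd_swap] at h1
        exact lt_asymm h1 h2'
    refine hsub.trans (le_of_eq ?_)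
    rw [edgeSum, edgeSum, sum_mul_sum, ← univ_product_univ, sum_product]
  have hc : 0 ≤ Cτ * (‖((η : ℂ))⁻¹‖ ^ 2 * ε) := by positivity
  nlinarith [mul_le_mul_of_nonneg_left hpairs hc]

/-- **`‖⟨A, Δ′(U)B⟩_{(3.10)}‖ ≤ 2·C_τ·ε·|η|^d·η⁻²·Σ_p (Σ_{∂p}‖A‖)(Σ_{∂p}‖B‖)`** — the curvature form is `O(ε)` plaquette by plaquette.
[cite: Balaban1985BackgroundPropagators, (3.10) p.392, (3.69) p.404] -/
theorem norm_curvForm_le (hCτ : 0 ≤ Cτ) {ε : ℝ} (hpl : ∀ p : B9SectCLatticeCarrier.Plaq d Pd, ‖(plaqHolU U p : 𝔸) - 1‖ ≤ ε) (A B : Bond d Pd → 𝔸) :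
    ‖curvForm τ η U A B‖ ≤ 2 * Cτ * ε * |η| ^ d * ‖((η : ℂ))⁻¹‖ ^ 2 * ∑ p : B9SectCLatticeCarrier.Plaq d Pd, edgeSum p A * edgeSum p B := by
  rw [curvForm_apply, mul_sum]
  refine (norm_sum_le _ _).trans (sum_le_sum fun p _ => ?_)
  rw [norm_mul, norm_pow, Complex.norm_real, Real.norm_eq_abs]
  have h1 := norm_curvBlock₁_le hU hτ η hCτ (hpl p) A B
  have h2 := norm_curvBlock₂_le hU hτ η hCτ (hpl p) A B
  have h := norm_add_le (curvBlock₁ τ η U p A B) (curvBlock₂ τ η U p A B)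
  have hpos : 0 ≤ |η| ^ d := by positivity
  nlinarith [mul_le_mul_of_nonneg_left (h.trans (add_le_add h1 h2)) hpos]

end Plaquette

/-! ## §2 Incidence: every bond lies on at most `4d` (plaquette, edge-slot) pairs -/

section Incidence

/-- the direction of `p` complementary to that of its `k`-th edge. [cite: Balaban1985BackgroundPropagators, (3.2) p.390] -/
def otherDir (p : B9SectCLatticeCarrier.Plaq d Pd) (k : Fin 4) : Fin d := ![p.2.1.2, p.2.1.1, p.2.1.2, p.2.1.1] k

/-- `(p, k) ↦ (e_k(p), k, other direction)` — a code from which `p` is recovered. [cite: Balaban1985BackgroundPropagators, (3.2) p.390] -/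
def edgeCode (pk : B9SectCLatticeCarrier.Plaq d Pd × Fin 4) : Bond d Pd × (Fin 4 × Fin d) := (edgeBond pk.1 pk.2, (pk.2, otherDir pk.1 pk.2))

/-- The code is injective: a plaquette is determined by one of its edges, the edge's slot and the other direction. [cite: Balaban1985BackgroundPropagators, (3.2) p.390] -/
theorem edgeCode_injective : Function.Injective (edgeCode (d := d) (Pd := Pd)) := by
  rintro ⟨⟨x, q⟩, k⟩ ⟨⟨x', q'⟩, k'⟩ h
  simp only [edgeCode, Prod.mk.injEq] at h
  obtain ⟨hb, hk, ho⟩ := h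
  subst hk
  have hqext : ∀ {a b : DirPair d}, a.1.1 = b.1.1 → a.1.2 = b.1.2 → a = b := fun h1 h2 => Subtype.ext (Prod.ext h1 h2)
  fin_cases k
  · have hb' : (shift q.1.2 x, q.1.1) = (shift q'.1.2 x', q'.1.1) := hb
    have ho' : q.1.2 = q'.1.2 := ho
    obtain ⟨hx, hμ⟩ := Prod.mk.inj hb'
    obtain rfl : q = q' := hqext hμ ho'
    obtain rfl : x = x' := by simpa [unshift_shift] using congrArg (unshift q.1.2) hx
    rfl
  · have hb' : (x, q.1.2) = (x', q'.1.2) := hb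
    have ho' : q.1.1 = q'.1.1 := ho
    obtain ⟨hx, hν⟩ := Prod.mk.inj hb'
    obtain rfl : q = q' := hqext ho' hν
    subst hx; rfl
  · have hb' : (x, q.1.1) = (x', q'.1.1) := hb
    have ho' : q.1.2 = q'.1.2 := ho
    obtain ⟨hx, hμ⟩ := Prod.mk.inj hb'
    obtain rfl : q = q' := hqext hμ ho'
    subst hx; rfl
  · have hb' : (shift q.1.1 x, q.1.2) = (shift q'.1.1 x', q'.1.2) := hb
    have ho' : q.1.1 = q'.1.1 := ho
    obtain ⟨hx, hν⟩ := Prod.mk.inj hb'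
    obtain rfl : q = q' := hqext ho' hν
    obtain rfl : x = x' := by simpa [unshift_shift] using congrArg (unshift q.1.1) hx
    rfl

/-- **Every bond lies on at most `4d` edge slots of plaquettes** (crude count: the code lands in `{b} × Fin 4 × Fin d`; print: `2(d−1)`).
[cite: Balaban1985BackgroundPropagators, (3.69) p.404] -/
theorem card_edge_fiber_le (b : Bond d Pd) :
    ((univ : Finset (B9SectCLatticeCarrier.Plaq d Pd × Fin 4)).filter fun pk => edgeBond pk.1 pk.2 = b).card ≤ 4 * d := by
  set S := (univ : Finset (B9SectCLatticeCarrier.Plaq d Pd × Fin 4)).filter fun pk => edgeBond pk.1 pk.2 = b with hS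
  have himg : S.image edgeCode ⊆ ({b} : Finset (Bond d Pd)) ×ˢ (univ : Finset (Fin 4 × Fin d)) := by
    intro c hc
    obtain ⟨pk, hpk, rfl⟩ := mem_image.1 hc
    rw [hS, mem_filter] at hpk
    simp [edgeCode, hpk.2]
  calc S.card = (S.image edgeCode).card := (card_image_of_injective S edgeCode_injective).symm
    _ ≤ (({b} : Finset (Bond d Pd)) ×ˢ (univ : Finset (Fin 4 × Fin d))).card := card_le_card himg
    _ = 4 * d := by simp

/-- **`Σ_{p,k} g(e_k(p)) ≤ 4d·Σ_b g(b)`** for nonnegative `g` — summing a bond quantity over all (plaquette, edge) slots.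
[cite: Balaban1985BackgroundPropagators, (3.69) p.404] -/
theorem sum_edge_le {g : Bond d Pd → ℝ} (hg : ∀ b, 0 ≤ g b) :
    ∑ pk : B9SectCLatticeCarrier.Plaq d Pd × Fin 4, g (edgeBond pk.1 pk.2) ≤ 4 * d * ∑ b : Bond d Pd, g b := by
  rw [← Finset.sum_fiberwise (univ : Finset (B9SectCLatticeCarrier.Plaq d Pd × Fin 4)) (fun pk : B9SectCLatticeCarrier.Plaq d Pd × Fin 4 => edgeBond pk.1 pk.2)
    (fun pk : B9SectCLatticeCarrier.Plaq d Pd × Fin 4 => g (edgeBond pk.1 pk.2)), mul_sum]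
  refine sum_le_sum fun b _ => ?_
  have hcard : (((univ : Finset (B9SectCLatticeCarrier.Plaq d Pd × Fin 4)).filter fun pk => edgeBond pk.1 pk.2 = b).card : ℝ) ≤ 4 * d := by
    exact_mod_cast card_edge_fiber_le (d := d) (Pd := Pd) b
  calc ∑ pk ∈ (univ : Finset (B9SectCLatticeCarrier.Plaq d Pd × Fin 4)).filter (fun pk => edgeBond pk.1 pk.2 = b), g (edgeBond pk.1 pk.2)
      = ∑ pk ∈ (univ : Finset (B9SectCLatticeCarrier.Plaq d Pd × Fin 4)).filter (fun pk => edgeBond pk.1 pk.2 = b), g b :=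
        sum_congr rfl fun pk hpk => by rw [(mem_filter.1 hpk).2]
    _ = (((univ : Finset (B9SectCLatticeCarrier.Plaq d Pd × Fin 4)).filter fun pk => edgeBond pk.1 pk.2 = b).card : ℝ) * g b := by
        rw [sum_const, nsmul_eq_mul]
    _ ≤ 4 * d * g b := mul_le_mul_of_nonneg_right hcard (hg b)

end Incidence

/-! ## §3 `Δ′(U)` is small on the `L²` space of `𝔤ᶜ`-valued bond functions -/

section L2

variable {𝔸 : Type*} [NormedRing 𝔸] [NormedAlgebra ℂ 𝔸] [StarRing 𝔸] [NormedStarGroup 𝔸] [StarModule ℂ 𝔸]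
  {W : Type*} [NormedAddCommGroup W] [InnerProductSpace ℂ W] [FiniteDimensional ℂ W] (φ : W ≃ₗ[ℂ] 𝔸) {c₀ : ℝ} [Fact (0 < c₀)]
  {τ : 𝔸 →ₗ[ℂ] ℂ} {Cτ : ℝ} (hτ : ∀ X, ‖τ X‖ ≤ Cτ * ‖X‖) (hCτ : 0 ≤ Cτ) {Mφ : ℝ} (hφ : ∀ w, ‖φ w‖ ≤ Mφ * ‖w‖) (η : ℝ)
  {U : Bond d Pd → 𝔸ˣ} (hU : ∀ b, ‖(U b : 𝔸)‖ ≤ 1 ∧ ‖(((U b)⁻¹ : 𝔸ˣ) : 𝔸)‖ ≤ 1) {ε : ℝ}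
  (hpl : ∀ p : B9SectCLatticeCarrier.Plaq d Pd, ‖(plaqHolU U p : 𝔸) - 1‖ ≤ ε)

include hτ hCτ hφ hU hpl in
/-- **`Δ′(U)` IS A SMALL OPERATOR ON THE `L²` BOND SPACE**: `‖⟪x, Δ′(U)x⟫‖ ≤ 32d·C_τ·M_φ²·(|η|^d/c₀)·η⁻²·ε·‖x‖²` — «with our assumptions on the
configuration U the operator Δ′ will be a bounded, small operator» (p. 392), at the level of the quadratic form of E157's `curvOp`; with print's
weight `c₀ = η^d` the prefactor is `32d·C_τ·M_φ²·η⁻²ε`, `η⁻²ε = O(α₀)` under (3.35). [cite: Balaban1985BackgroundPropagators, p.392, (3.69) p.404] -/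
theorem norm_inner_curvOp_self_le (hε : 0 ≤ ε) (x : BondL2K ℂ d Pd c₀ W) :
    ‖⟪x, curvOp φ τ η U x⟫_ℂ‖ ≤ 32 * d * Cτ * Mφ ^ 2 * (|η| ^ d / c₀) * (‖((η : ℂ))⁻¹‖ ^ 2 * ε) * ‖x‖ ^ 2 := by
  have hc₀ : 0 < c₀ := Fact.out
  rw [inner_curvOp]
  set X : Bond d Pd → 𝔸 := toAlg φ x with hX
  -- the form bound, with `‖(X b)*‖ = ‖X b‖`
  have hstar : ∀ p, edgeSum p (star X) = edgeSum p X := fun p => sum_congr rfl fun k _ => by rw [Pi.star_apply, norm_star]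
  have h1 : ‖curvForm τ η U (star X) X‖ ≤ 2 * Cτ * ε * |η| ^ d * ‖((η : ℂ))⁻¹‖ ^ 2 * ∑ p : B9SectCLatticeCarrier.Plaq d Pd, edgeSum p X ^ 2 := by
    refine (norm_curvForm_le hU hτ η hCτ hpl (star X) X).trans (le_of_eq ?_)
    congr 1
    exact sum_congr rfl fun p _ => by rw [hstar, sq]
  -- `(Σ_{4 edges})² ≤ 4·Σ squares`, then the incidence count
  have h2 : ∑ p : B9SectCLatticeCarrier.Plaq d Pd, edgeSum p X ^ 2 ≤ 4 * (4 * d) * ∑ b : Bond d Pd, ‖X b‖ ^ 2 := by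
    have hsq : ∀ p : B9SectCLatticeCarrier.Plaq d Pd, edgeSum p X ^ 2 ≤ 4 * ∑ k : Fin 4, ‖X (edgeBond p k)‖ ^ 2 := fun p => by
      have h := sq_sum_le_card_mul_sum_sq (s := (univ : Finset (Fin 4))) (f := fun k => ‖X (edgeBond p k)‖)
      simpa using h
    calc ∑ p : B9SectCLatticeCarrier.Plaq d Pd, edgeSum p X ^ 2 ≤ ∑ p : B9SectCLatticeCarrier.Plaq d Pd, 4 * ∑ k : Fin 4, ‖X (edgeBond p k)‖ ^ 2 := sum_le_sum fun p _ => hsq p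
      _ = 4 * ∑ pk : B9SectCLatticeCarrier.Plaq d Pd × Fin 4, ‖X (edgeBond pk.1 pk.2)‖ ^ 2 := by
          rw [← mul_sum]; congr 1
          exact (Fintype.sum_prod_type (fun pk : B9SectCLatticeCarrier.Plaq d Pd × Fin 4 => ‖X (edgeBond pk.1 pk.2)‖ ^ 2)).symm
      _ ≤ 4 * (4 * d * ∑ b : Bond d Pd, ‖X b‖ ^ 2) :=
          mul_le_mul_of_nonneg_left (sum_edge_le (g := fun b => ‖X b‖ ^ 2) fun b => sq_nonneg _) (by norm_num)
      _ = 4 * (4 * d) * ∑ b : Bond d Pd, ‖X b‖ ^ 2 := by ring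
  -- `‖X b‖ = ‖φ(x b)‖ ≤ M_φ‖x b‖`, and `Σ_b c₀‖x b‖² = ‖x‖²`
  have h3 : ∑ b : Bond d Pd, ‖X b‖ ^ 2 ≤ Mφ ^ 2 * (‖x‖ ^ 2 / c₀) := by
    have hn : ‖x‖ ^ 2 = ∑ b : Bond d Pd, c₀ * ‖WL2.equiv ℂ _ W x b‖ ^ 2 := WL2.norm_sq x
    have hsum : ‖x‖ ^ 2 / c₀ = ∑ b : Bond d Pd, ‖WL2.equiv ℂ _ W x b‖ ^ 2 := by
      rw [hn, ← mul_sum, mul_div_cancel_left₀ _ hc₀.ne']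
    rw [hsum, mul_sum]
    refine sum_le_sum fun b _ => ?_
    have hb : ‖X b‖ ≤ Mφ * ‖WL2.equiv ℂ _ W x b‖ := by rw [hX]; exact hφ _
    calc ‖X b‖ ^ 2 ≤ (Mφ * ‖WL2.equiv ℂ _ W x b‖) ^ 2 := by gcongr
      _ = Mφ ^ 2 * ‖WL2.equiv ℂ _ W x b‖ ^ 2 := by ring
  have hA : 0 ≤ 2 * Cτ * ε * |η| ^ d * ‖((η : ℂ))⁻¹‖ ^ 2 := by positivity
  calc ‖curvForm τ η U (star X) X‖ ≤ 2 * Cτ * ε * |η| ^ d * ‖((η : ℂ))⁻¹‖ ^ 2 * ∑ p : B9SectCLatticeCarrier.Plaq d Pd, edgeSum p X ^ 2 := h1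
    _ ≤ 2 * Cτ * ε * |η| ^ d * ‖((η : ℂ))⁻¹‖ ^ 2 * (4 * (4 * d) * (Mφ ^ 2 * (‖x‖ ^ 2 / c₀))) := by
        refine mul_le_mul_of_nonneg_left (h2.trans ?_) hA
        exact mul_le_mul_of_nonneg_left h3 (by positivity)
    _ = 32 * d * Cτ * Mφ ^ 2 * (|η| ^ d / c₀) * (‖((η : ℂ))⁻¹‖ ^ 2 * ε) * ‖x‖ ^ 2 := by
        field_simp
        ring

end L2

/-! ## §4 The displayed positivity SPLITS: `hpos` from the coercivity of the principal gauge-fixed operator -/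

section Split

variable {𝔸 : Type*} [NormedRing 𝔸] [NormedAlgebra ℂ 𝔸] [StarRing 𝔸] [StarModule ℂ 𝔸]
  {W : Type*} [NormedAddCommGroup W] [InnerProductSpace ℂ W] [FiniteDimensional ℂ W] (φ : W ≃ₗ[ℂ] 𝔸) {c₀ : ℝ} [Fact (0 < c₀)]
  (τ : 𝔸 →ₗ[ℂ] ℂ) (η : ℝ) (U : Bond d Pd → 𝔸ˣ) {F : Type*} [NormedAddCommGroup F] [InnerProductSpace ℂ F] [FiniteDimensional ℂ F]
  (c : ℂ) (R S : Bond d Pd → W →ₗ[ℂ] W) (Rr : SiteL2K ℂ d Pd c₀ W →ₗ[ℂ] SiteL2K ℂ d Pd c₀ W) (Q : BondL2K ℂ d Pd c₀ W →ₗ[ℂ] F) (a : ℝ)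

/-- **`hpos` REDUCED TO THE PRINCIPAL COERCIVITY**: if the quadratic form of `Δ′(U)` is `K`-bounded (§3) and the principal gauge-fixed operator
`D*D + DRD* + aQ*Q` (E157's `principalOpK` in `laplaceALatticeK`) is coercive with `γ > K`, then the assembled `Δ_a(U)` (with `Δ := hessOp =
principalOpK + curvOp`) is positive definite — print's «treated as a small perturbation of D*D». The coercivity is the content of [B9] Thm 3.11 /
of [4] at the flat background and stays DISPLAYED. [cite: Balaban1985BackgroundPropagators, p.392, Thm 3.11 p.416] -/
theorem hpos_of_principal_coercive {K γ : ℝ} (hK : ∀ x : BondL2K ℂ d Pd c₀ W, ‖⟪x, curvOp φ τ η U x⟫_ℂ‖ ≤ K * ‖x‖ ^ 2)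
    (hγ : ∀ x : BondL2K ℂ d Pd c₀ W, γ * ‖x‖ ^ 2 ≤ RCLike.re ⟪x, laplaceALatticeK c R S (principalOpK φ η U) Rr Q a x⟫_ℂ) (hKγ : K < γ)
    (x : BondL2K ℂ d Pd c₀ W) (hx : x ≠ 0) :
    0 < RCLike.re ⟪x, laplaceALatticeK c R S (hessOp φ η U τ) Rr Q a x⟫_ℂ := by
  have hsplit : laplaceALatticeK c R S (hessOp φ η U τ) Rr Q a x = laplaceALatticeK c R S (principalOpK φ η U) Rr Q a x + curvOp φ τ η U x := by
    simp only [laplaceALatticeK, B11Eq103H1Complex.laplaceAK_apply, hessOp_apply]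
    abel
  rw [hsplit, inner_add_right, map_add]
  have h1 := hγ x
  have h2 : -(K * ‖x‖ ^ 2) ≤ RCLike.re ⟪x, curvOp φ τ η U x⟫_ℂ := by
    have h := (RCLike.abs_re_le_norm ⟪x, curvOp φ τ η U x⟫_ℂ).trans (hK x)
    rw [abs_le] at h
    exact h.1
  have hx2 : 0 < ‖x‖ ^ 2 := by positivity
  nlinarith

end Split

/-! ## §5 Composed: `hpos` from the principal coercivity and the displayed smallness letters -/

section Composed

variable {𝔸 : Type*} [NormedRing 𝔸] [NormedAlgebra ℂ 𝔸] [StarRing 𝔸] [NormedStarGroup 𝔸] [StarModule ℂ 𝔸]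
  {W : Type*} [NormedAddCommGroup W] [InnerProductSpace ℂ W] [FiniteDimensional ℂ W] (φ : W ≃ₗ[ℂ] 𝔸) {c₀ : ℝ} [Fact (0 < c₀)]
  {τ : 𝔸 →ₗ[ℂ] ℂ} {Cτ : ℝ} (hτ : ∀ X, ‖τ X‖ ≤ Cτ * ‖X‖) (hCτ : 0 ≤ Cτ) {Mφ : ℝ} (hφ : ∀ w, ‖φ w‖ ≤ Mφ * ‖w‖) (η : ℝ)
  {U : Bond d Pd → 𝔸ˣ} (hU : ∀ b, ‖(U b : 𝔸)‖ ≤ 1 ∧ ‖(((U b)⁻¹ : 𝔸ˣ) : 𝔸)‖ ≤ 1) {ε : ℝ}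
  (hpl : ∀ p : B9SectCLatticeCarrier.Plaq d Pd, ‖(plaqHolU U p : 𝔸) - 1‖ ≤ ε) (hε : 0 ≤ ε)
  {F : Type*} [NormedAddCommGroup F] [InnerProductSpace ℂ F] [FiniteDimensional ℂ F]
  (c : ℂ) (R S : Bond d Pd → W →ₗ[ℂ] W) (Rr : SiteL2K ℂ d Pd c₀ W →ₗ[ℂ] SiteL2K ℂ d Pd c₀ W) (Q : BondL2K ℂ d Pd c₀ W →ₗ[ℂ] F) (a : ℝ)

include hτ hCτ hφ hU hpl hε in
/-- **THE CHAIN'S `hpos` FROM THE PRINCIPAL COERCIVITY AND THE SMALLNESS LETTERS** (§3 + §4): if the principal gauge-fixed operator is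
coercive with a constant `γ` exceeding the perturbation constant `32d·C_τ·M_φ²·(|η|^d/c₀)·η⁻²ε`, the assembled `Δ_a(U)` at `Δ := hessOp` is
positive definite — at the slots of `B9Eq326OperatorAssembly.laplaceAofU` / `B9Eq315QTorus.laplaceAofBackground` / `B9Eq326OperatorTower.laplaceAk`
this is literally their displayed `hpos` (definitional unfolding). [cite: Balaban1985BackgroundPropagators, p.392, Thm 3.11 p.416, (3.69) p.404] -/
theorem hpos_of_smallCurvature {γ : ℝ}
    (hγ : ∀ x : BondL2K ℂ d Pd c₀ W, γ * ‖x‖ ^ 2 ≤ RCLike.re ⟪x, laplaceALatticeK c R S (principalOpK φ η U) Rr Q a x⟫_ℂ)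
    (hsmall : 32 * d * Cτ * Mφ ^ 2 * (|η| ^ d / c₀) * (‖((η : ℂ))⁻¹‖ ^ 2 * ε) < γ) (x : BondL2K ℂ d Pd c₀ W) (hx : x ≠ 0) :
    0 < RCLike.re ⟪x, laplaceALatticeK c R S (hessOp φ η U τ) Rr Q a x⟫_ℂ :=
  hpos_of_principal_coercive φ τ η U c R S Rr Q a (norm_inner_curvOp_self_le φ hτ hCτ hφ η hU hpl hε) hγ hsmall x hx

end Composed

end Literature.MathematicalPhysics.QuantumFieldTheory.Balaban1983to89.B9Ineq369CurvatureSmall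

end
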